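import Literature.NumberTheory.EllipticCurves.IwasawaAlgebraStructureProofs
import Literature.NumberTheory.EllipticCurves.IwasawaAlgebraCharIdealProofs
import Literature.RingTheory.PowerSeries.ResidualOrderAssociated
import Mathlib.RingTheory.Polynomial.Eisenstein.Distinguished
import HarnessLib

/-!
# The characteristic power series of a finitely generated torsion `Λ = ℤ_p⟦T⟧`-module is `p^μ · g₀` with
# `ḡ₀ ≠ 0` of order `λ` (Washington §13.2) — the bridge from MODULE invariants to the residual-order hinge

For a finitely generated torsion `Λ`-module `M` the structure theorem (tree:
`exists_isPseudoIsomorphism_elementary_holds`) gives `M ∼ ⨁ Λ/(p^{μᵢ}) ⊕ ⨁ Λ/(fⱼ^{nⱼ})` with `fⱼ` distinguished,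
`char(M) = (p^{∑ μᵢ} ∏ fⱼ^{nⱼ})` (`charIdeal_eq_span_holds`), `μ(M) = ∑ μᵢ` (`muInvariant_eq_sum_holds`) and
`λ(M) = ∑ nⱼ deg fⱼ` (`lambdaInvariant_eq_sum_natDegree_holds`). Since a distinguished polynomial reduces to
`X^{deg}` modulo `p` (Mathlib `Polynomial.IsDistinguishedAt.map_eq_X_pow` / `coe_natDegree_eq_order_map`), the
generator has the shape used by the «one divisibility + equal invariants ⟹ equality» hinge of
`Literature/RingTheory/PowerSeries/ResidualOrderAssociated.lean`:

* `exists_charIdeal_eq_span_C_pow_mu_mul` — `∃ g₀, char(M) = (C(p^{μ(M)}) · g₀) ∧ ḡ₀ ≠ 0 ∧ ord ḡ₀ = λ(M)`.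

So «`μ(Q) = μ(M)` and `λ(Q) = λ(M)`» for a power series `Q` dividing / divisible by the generator is exactly the
hypothesis list of `associated_of_dvd_of_eq_mul_of_order_map_residue_eq` with `c = C(p^{μ(M)})`. Auxiliary:
`map_residue_coe_ne_zero_of_isDistinguishedAt`, `order_map_residue_coe_of_isDistinguishedAt` (one distinguished
polynomial), `order_pow_of_ne_zero`, and the list form `order_map_residue_prod_pow_of_isDistinguishedAt`. Filed for
line `eisenstein-resource-bdp-line` of crux stmt-BirchSwinnertonDyer-20372 (critic idea-crit-10 V#17, target S2d and its
use in S2b/S2c), but nothing here is specific to BSD.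

References: L. Washington, *Introduction to Cyclotomic Fields*, GTM 83, §13.2 (after Thm. 13.12: `f(T) = p^μ P(T) U(T)`,
`λ = deg P`) [Washington1997]; R. Greenberg – V. Vatsal, Invent. Math. 142 (2000) §1 p. 18 (1)–(2) [GreenbergVatsal2000].
-/

noncomputable section

open scoped Polynomial

namespace Literature.NumberTheory.EllipticCurves

open _root_.PowerSeries _root_.IsLocalRing

variable {p : ℕ} [Fact p.Prime]

/-- A power series over a domain: `ord (φ^n) = n • ord φ`. [folklore] -/
private theorem order_pow_eq_nsmul {k : Type*} [Semiring k] [Nontrivial k] [NoZeroDivisors k] (φ : k⟦X⟧) (n : ℕ) :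
    (φ ^ n).order = n • φ.order := by
  induction n with
  | zero => simp [order_one]
  | succ n ih => rw [pow_succ, order_mul, ih, succ_nsmul]

/-- A distinguished polynomial over `ℤ_p`, read in `Λ = ℤ_p⟦T⟧`, has NON-ZERO reduction modulo `p` …
[cite: Washington1997, §7.1 (distinguished polynomials) and §13.2] -/
theorem map_residue_coe_ne_zero_of_isDistinguishedAt {f : ℤ_[p][X]}
    (hf : f.IsDistinguishedAt (maximalIdeal ℤ_[p])) :
    PowerSeries.map (residue ℤ_[p]) (f : IwasawaAlgebra p) ≠ 0 :=
  hf.map_ne_zero_of_eq_mul (f : ℤ_[p]⟦X⟧) 1 (by simp) (by simp)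

/-- … of order exactly its degree (`f ≡ X^{deg f} mod p`). [cite: Washington1997, §7.1 and §13.2 (`λ = deg P`)] -/
theorem order_map_residue_coe_of_isDistinguishedAt {f : ℤ_[p][X]}
    (hf : f.IsDistinguishedAt (maximalIdeal ℤ_[p])) :
    (PowerSeries.map (residue ℤ_[p]) (f : IwasawaAlgebra p)).order = f.natDegree :=
  (hf.coe_natDegree_eq_order_map (f : ℤ_[p]⟦X⟧) 1 (by simp) (by simp)).symm

/-- The list form: for distinguished `fⱼ` with exponents `nⱼ`, the product `∏ fⱼ^{nⱼ} ∈ Λ` has non-zero reduction of order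
`∑ nⱼ deg fⱼ`. [cite: Washington1997, §13.2 (after Thm. 13.12)] -/
theorem order_map_residue_prod_pow_of_isDistinguishedAt (fs : List (ℤ_[p][X] × ℕ))
    (hfs : ∀ f ∈ fs, f.1.IsDistinguishedAt (maximalIdeal ℤ_[p])) :
    PowerSeries.map (residue ℤ_[p]) ((fs.map fun f => (f.1 : IwasawaAlgebra p) ^ f.2).prod) ≠ 0 ∧
      (PowerSeries.map (residue ℤ_[p]) ((fs.map fun f => (f.1 : IwasawaAlgebra p) ^ f.2).prod)).order =
        ((fs.map fun f => f.2 * f.1.natDegree).sum : ℕ) := by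
  induction fs with
  | nil => simp
  | cons f fs ih =>
    have hf : f.1.IsDistinguishedAt (maximalIdeal ℤ_[p]) := hfs f (by simp)
    obtain ⟨ih0, ihord⟩ := ih (fun g hg => hfs g (by simp [hg]))
    have hf0 := map_residue_coe_ne_zero_of_isDistinguishedAt hf
    have hford := order_map_residue_coe_of_isDistinguishedAt hf
    have hpow0 : PowerSeries.map (residue ℤ_[p]) ((f.1 : IwasawaAlgebra p) ^ f.2) ≠ 0 := by
      rw [map_pow]; exact pow_ne_zero _ hf0
    refine ⟨?_, ?_⟩
    · rw [List.map_cons, List.prod_cons, map_mul]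
      exact mul_ne_zero hpow0 ih0
    · rw [List.map_cons, List.prod_cons, map_mul, order_mul, ihord, map_pow, order_pow_eq_nsmul, hford,
        List.map_cons, List.sum_cons, Nat.cast_add, Nat.cast_mul]
      simp [nsmul_eq_mul]

/-- **The characteristic power series is `p^{μ} · g₀` with `ḡ₀ ≠ 0` of order `λ`.** For a finitely generated
torsion `Λ = ℤ_p⟦T⟧`-module `M` there is `g₀ ∈ Λ` with `char_Λ(M) = (C(p^{μ(M)}) · g₀)`, reduction `ḡ₀ ≠ 0` in
`𝔽_p⟦T⟧`, and `ord ḡ₀ = λ(M)` — from the tree's structure theorem, `char(M) = (p^{∑μᵢ} ∏ fⱼ^{nⱼ})`,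
`μ(M) = ∑ μᵢ`, `λ(M) = ∑ nⱼ deg fⱼ`, and the reduction of distinguished polynomials. This is the input shape of
`Literature.RingTheory.PowerSeries.associated_of_dvd_of_eq_mul_of_order_map_residue_eq` (take `c = C(p^{μ(M)})`).
[cite: Washington1997, §13.2 (Thm. 13.12 and the definition of `λ`, `μ` after it)] [cite: GreenbergVatsal2000, §1 p. 18, (1)–(2)] -/
theorem exists_charIdeal_eq_span_C_pow_mu_mul (M : Type*) [AddCommGroup M]
    [_root_.Module (IwasawaAlgebra p) M] [_root_.Module.Finite (IwasawaAlgebra p) M]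
    (hM : _root_.Module.IsTorsion (IwasawaAlgebra p) M) :
    ∃ g₀ : IwasawaAlgebra p,
      Module.charIdeal (IwasawaAlgebra p) M =
          Ideal.span {(PowerSeries.C ((p : ℤ_[p]) ^ muInvariant p M) : IwasawaAlgebra p) * g₀} ∧
        PowerSeries.map (residue ℤ_[p]) g₀ ≠ 0 ∧
        (PowerSeries.map (residue ℤ_[p]) g₀).order = lambdaInvariant p M := by
  obtain ⟨μs, fs, _hμ, hfs, hψ⟩ := exists_isPseudoIsomorphism_elementary_holds (p := p) M hM
  have hfs' : ∀ f ∈ fs, f.1.IsDistinguishedAt (maximalIdeal ℤ_[p]) := fun f hf => (hfs f hf).1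
  refine ⟨(fs.map fun f => (f.1 : IwasawaAlgebra p) ^ f.2).prod, ?_, ?_, ?_⟩
  · rw [charIdeal_eq_span_holds (p := p) M hfs' hψ, muInvariant_eq_sum_holds (p := p) M hfs' hψ]
    rfl
  · exact (order_map_residue_prod_pow_of_isDistinguishedAt fs hfs').1
  · rw [(order_map_residue_prod_pow_of_isDistinguishedAt fs hfs').2,
      lambdaInvariant_eq_sum_natDegree_holds (p := p) M hfs' hψ]

end Literature.NumberTheory.EllipticCurves

end
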